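import Summits.ResolutionOfSingularities.ResolutionOfSingularities.Theorems.WildConesCampaignW46AtomGermTjurina
import Literature.RingTheory.MvPowerSeries.PartialDerivative
import HarnessLib

/-!
# [OURS · L1 W4.6, rungs (i)/(ii) — the dictionary, SCHEME HALF, brick 3b] The Tjurina ideal of the atom germ
# `z^p − a(u)` written with honest partial derivatives

Cell res-hironaka (LADDER-RESOLUTION rung L, D-0089), slot W4.6, seat res-L1-s46-pv-2 (gen 2). Host: route
`WildCones`, crux `ClassicalRegimes` (stmt-ResolutionOfSingularities-16884), `--supports … --as helper`.

HONEST FRAMING. Everything here is OURS — elementary power-series algebra about route `WildCones`' typed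
coefficient calculus; NOTHING here is a statement of H. Hironaka's manuscript [Hironaka2017] and nothing of it is
used; no FACT-LIST premise. AI review is weaker than expert review.

Companion of `Theorems/WildConesCampaignW46AtomGermTjurina.lean` (`isol_iff_finite_tjurina`: `Isol c` iff
`κ⟦z,u⟧/((z^p − ser c) + (jac c) κ⟦z,u⟧)` is finite over `κ`). Here the ideal `(z^p − ser c) + (jac c) κ⟦z,u⟧` is
identified with the TJURINA IDEAL `(f, ∂f/∂z, ∂f/∂u_1, …, ∂f/∂u_n)` of `f = z^p − ser c` computed with the tree's
formal partial derivative `Literature.RingTheory.MvPowerSeries.pd` (`PartialDerivative.lean`): in characteristic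
`p`, `∂f/∂z = p z^{p−1} = 0` (`pd_none_X_none_pow`, `pd_none_rename_some`) and `∂f/∂u_k = −∂(ser c)/∂u_k` placed in
`κ⟦z,u⟧` (`pd_some_rename_some`; on `u`-series the tree's `pd` IS the route's `WildCones.pd`, `pd_eq_pd`), whence
`tjurina_eq`, `map_jac_eq` and the literal form `isol_iff_finite_tjurina'`.

References: `Literature/RingTheory/MvPowerSeries/PartialDerivative.lean`; G.-M. Greuel, C. Lossen, E. Shustin,
*Introduction to Singularities and Deformations* (2007), §I.1–I.2 (Tjurina ideal). [GreuelLossenShustin2007]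
[folklore]
-/

noncomputable section

-- single-problem summit: the doubled namespace component `ResolutionOfSingularities` is forced
set_option linter.dupNamespace false

open scoped BigOperators Classical
open MvPowerSeries IsLocalRing

namespace Summit.ResolutionOfSingularities.ResolutionOfSingularities.Theorems

namespace CampaignW46.AtomGerm

open WildCones
open Literature.RingTheory.MvPowerSeries (optionEquivLeft coeff_coeff_optionEquivLeft optionEquivLeft_X_none)

variable {n : ℕ} {κ : Type} [Field κ] {p : ℕ}

/-! ## The Tjurina ideal of the atom -/

/-- On `u`-series the tree's formal partial derivative IS route `WildCones`' `pd`. [folklore] -/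
theorem pd_eq_pd (k : Fin n) (g : MvPowerSeries (Fin n) κ) :
    WildCones.pd n κ k g = Literature.RingTheory.MvPowerSeries.pd k g := rfl

/-- Values of a placed exponent. [folklore] -/
theorem embDomain_some_apply_some (d : Fin n →₀ ℕ) (k : Fin n) :
    (Finsupp.embDomain ⟨some, Option.some_injective _⟩ d : Option (Fin n) →₀ ℕ) (some k) = d k :=
  Finsupp.embDomain_apply_self _ d k

/-- `∂/∂u_k` of a placed `u`-series is the placed `∂/∂u_k`. [folklore] -/
theorem pd_some_rename_some (k : Fin n) (g : MvPowerSeries (Fin n) κ) :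
    Literature.RingTheory.MvPowerSeries.pd (some k) (rename (some : Fin n → Option (Fin n)) g) =
      rename (some : Fin n → Option (Fin n)) (Literature.RingTheory.MvPowerSeries.pd k g) := by
  ext e
  rw [Literature.RingTheory.MvPowerSeries.coeff_pd]
  by_cases h0 : e none = 0
  · have he : e = Finsupp.embDomain ⟨some, Option.some_injective _⟩ e.some := by
      rw [← optionElim_zero_eq_embDomain, ← h0, Literature.RingTheory.MvPowerSeries.optionElim_some_self]
    set d := e.some with hd
    rw [he, embDomain_some_apply_some,
      show (Finsupp.embDomain ⟨some, Option.some_injective _⟩ d : Option (Fin n) →₀ ℕ) +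
          Finsupp.single (some k) 1 = Finsupp.embDomain ⟨some, Option.some_injective _⟩ (d + Finsupp.single k 1) by
        rw [Finsupp.embDomain_add, Finsupp.embDomain_single]; rfl,
      show (rename (some : Fin n → Option (Fin n)) : MvPowerSeries (Fin n) κ →ₐ[κ] MvPowerSeries (Option (Fin n)) κ) =
        rename (⟨some, Option.some_injective _⟩ : Fin n ↪ Option (Fin n)) from rfl,
      coeff_embDomain_rename, coeff_embDomain_rename, Literature.RingTheory.MvPowerSeries.coeff_pd]
  · rw [coeff_rename_eq_zero _ _ (not_mem_range_mapDomain_some (e := e + Finsupp.single (some k) 1) ?_),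
      coeff_rename_eq_zero _ _ (not_mem_range_mapDomain_some h0), mul_zero]
    rw [Finsupp.add_apply, Finsupp.single_eq_of_ne (Option.some_ne_none k).symm, add_zero]
    exact h0

/-- `∂/∂z` of a placed `u`-series vanishes. [folklore] -/
theorem pd_none_rename_some (g : MvPowerSeries (Fin n) κ) :
    Literature.RingTheory.MvPowerSeries.pd none (rename (some : Fin n → Option (Fin n)) g) = 0 := by
  ext e
  rw [Literature.RingTheory.MvPowerSeries.coeff_pd, map_zero, coeff_rename_eq_zero _ _
    (not_mem_range_mapDomain_some (e := e + Finsupp.single none 1) ?_), mul_zero]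
  rw [Finsupp.add_apply, Finsupp.single_eq_same]
  exact Nat.succ_ne_zero _

/-- `∂(z^p)/∂z = 0` in characteristic `p`. [folklore] -/
theorem pd_none_X_none_pow [Fact p.Prime] [CharP κ p] :
    Literature.RingTheory.MvPowerSeries.pd none ((X none : MvPowerSeries (Option (Fin n)) κ) ^ p) = 0 := by
  ext e
  rw [Literature.RingTheory.MvPowerSeries.coeff_pd, map_zero, coeff_X_pow]
  split_ifs with h
  · have h1 : e none + 1 = p := by
      have := congrArg (fun x : Option (Fin n) →₀ ℕ => x none) h
      simpa using this
    rw [h1, CharP.cast_eq_zero, zero_mul]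
  · rw [mul_zero]

/-- `∂(z^p)/∂u_k = 0`. [folklore] -/
theorem pd_some_X_none_pow (k : Fin n) :
    Literature.RingTheory.MvPowerSeries.pd (some k) ((X none : MvPowerSeries (Option (Fin n)) κ) ^ p) = 0 := by
  ext e
  rw [Literature.RingTheory.MvPowerSeries.coeff_pd, map_zero, coeff_X_pow, if_neg, mul_zero]
  intro h
  have := congrArg (fun x : Option (Fin n) →₀ ℕ => x (some k)) h
  simp at this

/-- [OURS · L1 W4.6] **The Tjurina ideal of the atom** `f = z^p − a` (`a` a placed `u`-series) in characteristic
`p`: `(f) + (∂f/∂z) + (∂f/∂u_k : k) = (f) + (∂a/∂u_k : k)·κ⟦z,u⟧`. For `a = ser c` the right-hand summand is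
`(jac c) κ⟦z,u⟧` (`map_jac_eq`). [folklore] -/
theorem tjurina_eq [Fact p.Prime] [CharP κ p] (a : MvPowerSeries (Fin n) κ) :
    Ideal.span {(X none : MvPowerSeries (Option (Fin n)) κ) ^ p - rename (some : Fin n → Option (Fin n)) a} ⊔
      Ideal.span (Set.range fun o : Option (Fin n) => Literature.RingTheory.MvPowerSeries.pd o
        ((X none : MvPowerSeries (Option (Fin n)) κ) ^ p - rename (some : Fin n → Option (Fin n)) a)) =
    Ideal.span {(X none : MvPowerSeries (Option (Fin n)) κ) ^ p - rename (some : Fin n → Option (Fin n)) a} ⊔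
      Ideal.span (Set.range fun k : Fin n =>
        rename (some : Fin n → Option (Fin n)) (Literature.RingTheory.MvPowerSeries.pd k a)) := by
  have hval : ∀ o : Option (Fin n), Literature.RingTheory.MvPowerSeries.pd o
      ((X none : MvPowerSeries (Option (Fin n)) κ) ^ p - rename (some : Fin n → Option (Fin n)) a) =
      o.elim 0 (fun k => - rename (some : Fin n → Option (Fin n)) (Literature.RingTheory.MvPowerSeries.pd k a)) := by
    intro o
    cases o with
    | none => rw [map_sub, pd_none_X_none_pow, pd_none_rename_some, sub_zero]; rfl
    | some k => rw [map_sub, pd_some_X_none_pow, pd_some_rename_some, zero_sub]; rfl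
  congr 1
  apply le_antisymm
  · rw [Ideal.span_le]
    rintro _ ⟨o, rfl⟩
    rw [SetLike.mem_coe]
    dsimp only
    rw [hval]
    cases o with
    | none => exact Ideal.zero_mem _
    | some k => exact (Ideal.neg_mem_iff _).2 (Ideal.subset_span ⟨k, rfl⟩)
  · rw [Ideal.span_le]
    rintro _ ⟨k, rfl⟩
    have h := Ideal.subset_span (s := Set.range fun o : Option (Fin n) => Literature.RingTheory.MvPowerSeries.pd o
        ((X none : MvPowerSeries (Option (Fin n)) κ) ^ p - rename (some : Fin n → Option (Fin n)) a)) ⟨some k, rfl⟩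
    rw [SetLike.mem_coe] at h ⊢
    dsimp only at h ⊢
    rw [hval] at h
    simpa using ((Ideal.neg_mem_iff _).2 h)

/-- The extension of `jac c` to `κ⟦z,u⟧` is generated by the placed partials. [folklore] -/
theorem map_jac_eq (c : (Fin n → ℕ) → κ) :
    (jac p n κ c).map (rename (some : Fin n → Option (Fin n)) : MvPowerSeries (Fin n) κ →ₐ[κ] _) =
      Ideal.span (Set.range fun k : Fin n =>
        rename (some : Fin n → Option (Fin n)) (Literature.RingTheory.MvPowerSeries.pd k (ser p n κ c))) := by
  unfold jac
  rw [Ideal.map_span, ← Set.range_comp]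
  rfl

/-- [OURS · L1 W4.6] The same with the Tjurina ideal written LITERALLY as `(f) + (∂f/∂x : x ∈ {z, u_1, …, u_n})`
for `f = z^p − ser c`, partial derivatives being the tree's `Literature.RingTheory.MvPowerSeries.pd`
(characteristic `p`). [folklore] -/
theorem isol_iff_finite_tjurina' [Fact p.Prime] [CharP κ p] (c : (Fin n → ℕ) → κ) :
    Isol p n κ c ↔ Module.Finite κ (MvPowerSeries (Option (Fin n)) κ ⧸
      (Ideal.span {(X none : MvPowerSeries (Option (Fin n)) κ) ^ p -
          rename (some : Fin n → Option (Fin n)) (ser p n κ c)} ⊔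
        Ideal.span (Set.range fun o : Option (Fin n) => Literature.RingTheory.MvPowerSeries.pd o
          ((X none : MvPowerSeries (Option (Fin n)) κ) ^ p - rename (some : Fin n → Option (Fin n)) (ser p n κ c))))) := by
  rw [tjurina_eq, ← map_jac_eq]
  exact isol_iff_finite_tjurina c

end CampaignW46.AtomGerm

end Summit.ResolutionOfSingularities.ResolutionOfSingularities.Theorems

end
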